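import Literature.ModelTheory.ExponentialFields.DefinableHomeomorph
import Literature.ModelTheory.ExponentialFields.SemialgebraicC1TriangulationLifting
import HarnessLib

/-!
# Functions and maps definable on a set, in an expansion of the real field

Vocabulary + kit for the o-minimal triangulation theorem (van den Dries 1998, Ch. 8) in
`L`-generality, continuing `DefinableHomeomorph.lean`: the `L`-definable analogues of the tree's
`IsSemialgebraicFunOn k s f` / `IsSemialgebraicMapOn k s F` (`Literature.NumberTheory.Transcendental`,
[BochnakCosteRoy1998, Def. 2.2.5]: "`f` is semialgebraic on `s` iff its graph over `s` is") for an
arbitrary first-order language `L` interpreted on `ℝ` — a function (map) is *definable on `s`* iff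
its graph over `s` is definable with parameters ([Dries1998, Ch. 1 (2.3)]: "a map `f : A → Rⁿ`,
`A ⊆ Rᵐ`, belongs to the structure if its graph does"). Same `Fin.snoc` / `Fin.append` graph
conventions as the semialgebraic notions, so that the semialgebraic triangulation files port
statement by statement.

## What is vendored (all API proved)

* `IsDefinableFunOn L s f`, `IsDefinableMapOn L s F` (definitions) with the unfolding lemmas
  `isDefinableFunOn_iff` / `isDefinableMapOn_iff` (graph as `{z | init z ∈ s ∧ z last = f (init z)}`).
* Closure kit: `of_definableFun` (Mathlib-definable total functions), `isDefinableFunOn_const`,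
  `isDefinableFunOn_apply`, `congr`, `mono`, `definable_source`, `comp_init`,
  `Set.Definable.setOf_init_mem`; the master lemma `IsDefinableFunOn.of_rel` (functions defined by
  a definable condition on the values of finitely many definable functions, cf. the tree's
  `IsSemialgebraicFunOn.of_rel`) and its instances `add`, `sub`, `mul`, `neg`, `max`, `min`, `div₀`,
  `finset_sum`, `sort_apply` (order statistics, via the tree's first-order characterisation
  `eq_sort_apply_iff`), for `L` an expansion of the real field (`IsRealFieldExpansion L`);
  `definable_setOf_le_last`, `definable_setOf_last_le` (sub/super-graphs).
* Maps: `isDefinableMapOn_iff_forall` (coordinatewise), `IsDefinableMapOn.of_forall`, `.apply`,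
  `.mono`, `.definable_sep_mem` (`{x ∈ s | F x ∈ t}`), `IsDefinableFunOn.comp_isDefinableMapOn`,
  `IsDefinableFunOn.of_finset_cover` (piecewise), `AffineMap.isDefinableFunOn`, and the bridges
  `IsDefinableHomeomorphOn.isDefinableMapOn` / `_symm`.

No named facts. Consumer: the o-minimal lifting lemma and triangulation theorem (vdD Ch. 8 (2.8),
(2.9)), for Buchner 1977 (`Riemannian/CutLocusDefinable.lean`).

## References

* [Dries1998] L. van den Dries, *Tame topology and o-minimal structures* (1998), Ch. 1 (2.3).
* [BochnakCosteRoy1998] J. Bochnak, M. Coste, M.-F. Roy, *Real Algebraic Geometry*, Def. 2.2.5,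
  Prop. 2.2.6 (the semialgebraic template).
-/

noncomputable section

open Set FirstOrder FirstOrder.Language
open Literature.NumberTheory.Transcendental (setOf_exists_eq_snoc setOf_exists_eq_append)

namespace Literature.ModelTheory.ExponentialFields

universe u v

section Defs

variable (L : FirstOrder.Language.{u, v}) [L.Structure ℝ] {n m l : ℕ}

/-- `f : ℝⁿ → ℝ` is **`L`-definable on `s ⊆ ℝⁿ`**: its graph over `s`, `{(x, f x) | x ∈ s} ⊆ ℝⁿ⁺¹`
(realised via `Fin.snoc`), is definable with parameters (the values of `f` off `s` are immaterial).
The `L`-definable analogue of `IsSemialgebraicFunOn`. [cite: Dries1998, Ch. 1 (2.3)] -/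
def IsDefinableFunOn (s : Set (Fin n → ℝ)) (f : (Fin n → ℝ) → ℝ) : Prop :=
  (univ : Set ℝ).Definable L {z : Fin (n + 1) → ℝ | ∃ x ∈ s, z = Fin.snoc x (f x)}

/-- `F : ℝⁿ → ℝᵐ` is **`L`-definable on `s ⊆ ℝⁿ`**: its graph over `s` (via `Fin.append`) is
definable with parameters. The `L`-definable analogue of `IsSemialgebraicMapOn`; it is the last
clause of `IsDefinableHomeomorphOn`. [cite: Dries1998, Ch. 1 (2.3)] -/
def IsDefinableMapOn (s : Set (Fin n → ℝ)) (F : (Fin n → ℝ) → (Fin m → ℝ)) : Prop :=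
  (univ : Set ℝ).Definable L {z : Fin (n + m) → ℝ | ∃ x ∈ s, z = Fin.append x (F x)}

variable {L}

/-- Unfolding: `f` is definable on `s` iff `{z | init z ∈ s ∧ z last = f (init z)}` is definable.
[cite: Dries1998, Ch. 1 (2.3)] -/
theorem isDefinableFunOn_iff {s : Set (Fin n → ℝ)} {f : (Fin n → ℝ) → ℝ} :
    IsDefinableFunOn L s f ↔ (univ : Set ℝ).Definable L
      {z : Fin (n + 1) → ℝ | Fin.init z ∈ s ∧ z (Fin.last n) = f (Fin.init z)} := by
  rw [IsDefinableFunOn, setOf_exists_eq_snoc]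

/-- Unfolding: `F` is definable on `s` iff `{z | z|ₙ ∈ s ∧ z|ᵐ = F (z|ₙ)}` is definable.
[cite: Dries1998, Ch. 1 (2.3)] -/
theorem isDefinableMapOn_iff {s : Set (Fin n → ℝ)} {F : (Fin n → ℝ) → (Fin m → ℝ)} :
    IsDefinableMapOn L s F ↔ (univ : Set ℝ).Definable L
      {z : Fin (n + m) → ℝ | (fun i => z (Fin.castAdd m i)) ∈ s ∧
        (fun j => z (Fin.natAdd n j)) = F (fun i => z (Fin.castAdd m i))} := by
  rw [IsDefinableMapOn, setOf_exists_eq_append]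

/-- The bridge from definable homeomorphisms: `Φ` is a definable map on `S`. [folklore] -/
theorem IsDefinableHomeomorphOn.isDefinableMapOn {S : Set (Fin n → ℝ)} {T : Set (Fin m → ℝ)}
    {Φ : (Fin n → ℝ) → (Fin m → ℝ)} {Ψ : (Fin m → ℝ) → (Fin n → ℝ)}
    (h : IsDefinableHomeomorphOn L S T Φ Ψ) : IsDefinableMapOn L S Φ :=
  h.definable_graph

/-- The bridge from definable homeomorphisms: `Ψ` is a definable map on `T`. [folklore] -/
theorem IsDefinableHomeomorphOn.isDefinableMapOn_symm {S : Set (Fin n → ℝ)} {T : Set (Fin m → ℝ)}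
    {Φ : (Fin n → ℝ) → (Fin m → ℝ)} {Ψ : (Fin m → ℝ) → (Fin n → ℝ)}
    (h : IsDefinableHomeomorphOn L S T Φ Ψ) : IsDefinableMapOn L T Ψ :=
  h.definable_graph_symm

/-! ### Cylinders -/

/-- `{z ∈ ℝⁿ⁺¹ | init z ∈ s}` is definable for definable `s`. [folklore] -/
theorem _root_.Set.Definable.setOf_init_mem {s : Set (Fin n → ℝ)}
    (hs : (univ : Set ℝ).Definable L s) :
    (univ : Set ℝ).Definable L {z : Fin (n + 1) → ℝ | Fin.init z ∈ s} :=
  hs.preimage_comp Fin.castSucc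

/-! ### Basic closure properties -/

namespace IsDefinableFunOn

variable {s t : Set (Fin n → ℝ)} {f g : (Fin n → ℝ) → ℝ}

/-- A total function definable in Mathlib's sense (`Set.DefinableFun`) is definable on every
definable set. [folklore] -/
theorem of_definableFun (hs : (univ : Set ℝ).Definable L s)
    (hf : (univ : Set ℝ).DefinableFun L f) : IsDefinableFunOn L s f := by
  rw [isDefinableFunOn_iff]
  refine definable_setOf_and hs.setOf_init_mem ?_
  -- the graph of `f`, re-indexed from `Option (Fin n)` to `Fin (n + 1)`
  have h := hf.preimage_comp (fun o : Option (Fin n) => o.elim (Fin.last n) Fin.castSucc)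
  convert h using 1
  ext z
  simp only [mem_setOf_eq, mem_preimage, Function.tupleGraph, Function.comp_def, Option.elim]
  exact eq_comm

/-- Functions agreeing on `s` are simultaneously definable on `s`. [folklore] -/
theorem congr (h : IsDefinableFunOn L s f) (hfg : ∀ x ∈ s, f x = g x) : IsDefinableFunOn L s g := by
  have heq : {z : Fin (n + 1) → ℝ | ∃ x ∈ s, z = Fin.snoc x (g x)} =
      {z : Fin (n + 1) → ℝ | ∃ x ∈ s, z = Fin.snoc x (f x)} := by
    ext z
    simp only [mem_setOf_eq]
    constructor
    · rintro ⟨x, hx, rfl⟩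
      exact ⟨x, hx, by rw [hfg x hx]⟩
    · rintro ⟨x, hx, rfl⟩
      exact ⟨x, hx, by rw [hfg x hx]⟩
  unfold IsDefinableFunOn
  rw [heq]
  exact h

/-- Restriction to a definable subset. [folklore] -/
theorem mono (h : IsDefinableFunOn L s f) (hts : t ⊆ s) (ht : (univ : Set ℝ).Definable L t) :
    IsDefinableFunOn L t f := by
  rw [isDefinableFunOn_iff] at h ⊢
  have heq : {z : Fin (n + 1) → ℝ | Fin.init z ∈ t ∧ z (Fin.last n) = f (Fin.init z)} =
      {z : Fin (n + 1) → ℝ | Fin.init z ∈ s ∧ z (Fin.last n) = f (Fin.init z)} ∩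
        {z : Fin (n + 1) → ℝ | Fin.init z ∈ t} := by
    ext z
    simp only [mem_setOf_eq, mem_inter_iff]
    constructor
    · rintro ⟨hz, h'⟩
      exact ⟨⟨hts hz, h'⟩, hz⟩
    · rintro ⟨⟨-, h'⟩, hz⟩
      exact ⟨hz, h'⟩
  rw [heq]
  exact h.inter ht.setOf_init_mem

/-- The domain of a function definable on `s` is definable (projection of the graph). [folklore] -/
theorem definable_source (h : IsDefinableFunOn L s f) : (univ : Set ℝ).Definable L s := by
  rw [isDefinableFunOn_iff] at h
  have key : s = {x : Fin n → ℝ | ∃ y : ℝ, (Fin.snoc x y : Fin (n + 1) → ℝ) ∈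
      {z : Fin (n + 1) → ℝ | Fin.init z ∈ s ∧ z (Fin.last n) = f (Fin.init z)}} := by
    ext x
    simp only [mem_setOf_eq, Fin.init_snoc, Fin.snoc_last]
    exact ⟨fun hx => ⟨f x, hx, rfl⟩, fun ⟨_, hx, _⟩ => hx⟩
  rw [key]
  refine definable_setOf_exists (P := fun (x : Fin n → ℝ) (y : ℝ) =>
    (Fin.snoc x y : Fin (n + 1) → ℝ) ∈
      {z : Fin (n + 1) → ℝ | Fin.init z ∈ s ∧ z (Fin.last n) = f (Fin.init z)}) ?_
  exact definable_setOf_snoc_mem' h Sum.inl (Sum.inr ())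

/-- Pre-composition with `init`: `z ↦ f (init z)` is definable on the cylinder over `s`. [folklore] -/
theorem comp_init (h : IsDefinableFunOn L s f) :
    IsDefinableFunOn L {z : Fin (n + 1) → ℝ | Fin.init z ∈ s} (fun z => f (Fin.init z)) := by
  rw [isDefinableFunOn_iff] at h ⊢
  -- re-index the graph of `f` along `(castSucc ∘ castSucc, last)`
  have h' := definable_setOf_snoc_mem' h (fun i : Fin n => Fin.castSucc (Fin.castSucc i))
    (Fin.last (n + 1)) (γ := Fin (n + 1 + 1))
  convert h' using 1
  ext z
  simp only [mem_setOf_eq, Fin.init_snoc, Fin.snoc_last]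
  rfl

end IsDefinableFunOn

/-- Constant functions are definable on definable sets. [folklore] -/
theorem isDefinableFunOn_const {s : Set (Fin n → ℝ)} (hs : (univ : Set ℝ).Definable L s) (c : ℝ) :
    IsDefinableFunOn L s (fun _ => c) :=
  IsDefinableFunOn.of_definableFun hs (definableFun_const' _ c)

/-- Coordinate functions are definable on definable sets. [folklore] -/
theorem isDefinableFunOn_apply {s : Set (Fin n → ℝ)} (hs : (univ : Set ℝ).Definable L s) (i : Fin n) :
    IsDefinableFunOn L s (fun x => x i) :=
  IsDefinableFunOn.of_definableFun hs (definableFun_proj i)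

/-! ### Functions defined by definable conditions on definable functions -/

section Rel

variable {s : Set (Fin n → ℝ)}

/-- **Functions defined by definable conditions on definable functions** (the master lemma; cf. the
tree's `IsSemialgebraicFunOn.of_rel`). If `f₀, …, f_{N-1}` are definable on a definable `s`,
`R(a, t)` is a definable relation on `ℝᴺ × ℝ`, and `H x` is the unique `t` with `R((fᵢ x)ᵢ, t)` for
`x ∈ s`, then `H` is definable on `s`: its graph is the projection along `a ∈ ℝᴺ` of
`{(x, t, a) | x ∈ s ∧ (∀ i, (x, aᵢ) ∈ Γ(fᵢ)) ∧ R(a, t)}`. [cite: Dries1998, Ch. 1 (2.3)] -/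
theorem IsDefinableFunOn.of_rel {N : ℕ} (hs : (univ : Set ℝ).Definable L s)
    {f : Fin N → (Fin n → ℝ) → ℝ} (hf : ∀ i, IsDefinableFunOn L s (f i))
    {R : (Fin N → ℝ) → ℝ → Prop}
    (hR : (univ : Set ℝ).Definable L {q : Fin (N + 1) → ℝ | R (Fin.init q) (q (Fin.last N))})
    {H : (Fin n → ℝ) → ℝ} (hH : ∀ x ∈ s, ∀ t, R (fun i => f i x) t ↔ t = H x) :
    IsDefinableFunOn L s H := by
  rw [isDefinableFunOn_iff]
  have hΓ : ∀ i, (univ : Set ℝ).Definable L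
      {z : Fin (n + 1) → ℝ | Fin.init z ∈ s ∧ z (Fin.last n) = f i (Fin.init z)} :=
    fun i => isDefinableFunOn_iff.1 (hf i)
  have key : {z : Fin (n + 1) → ℝ | Fin.init z ∈ s ∧ z (Fin.last n) = H (Fin.init z)} =
      {z : Fin (n + 1) → ℝ | Fin.init z ∈ s ∧ ∃ a : Fin N → ℝ,
        (∀ i, (Fin.snoc (Fin.init z) (a i) : Fin (n + 1) → ℝ) ∈
          {z' : Fin (n + 1) → ℝ | Fin.init z' ∈ s ∧ z' (Fin.last n) = f i (Fin.init z')}) ∧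
        R a (z (Fin.last n))} := by
    ext z
    simp only [mem_setOf_eq, Fin.init_snoc, Fin.snoc_last]
    constructor
    · rintro ⟨hz, hH'⟩
      refine ⟨hz, fun i => f i (Fin.init z), fun i => ⟨hz, rfl⟩, ?_⟩
      exact (hH _ hz _).2 hH'
    · rintro ⟨hz, a, ha, hRa⟩
      have : a = fun i => f i (Fin.init z) := funext fun i => (ha i).2
      subst this
      exact ⟨hz, (hH _ hz _).1 hRa⟩
  rw [key]
  refine definable_setOf_and hs.setOf_init_mem ?_
  refine definable_setOf_exists_fin (P := fun (z : Fin (n + 1) → ℝ) (a : Fin N → ℝ) =>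
    (∀ i, (Fin.snoc (Fin.init z) (a i) : Fin (n + 1) → ℝ) ∈
      {z' : Fin (n + 1) → ℝ | Fin.init z' ∈ s ∧ z' (Fin.last n) = f i (Fin.init z')}) ∧
      R a (z (Fin.last n))) ?_
  refine definable_setOf_and (definable_setOf_forall_index fun i => ?_) ?_
  · exact definable_setOf_snoc_mem' (hΓ i) (fun j : Fin n => Sum.inl (Fin.castSucc j)) (Sum.inr i)
  · have h := definable_setOf_snoc_mem' hR (fun i : Fin N => (Sum.inr i : Fin (n + 1) ⊕ Fin N))
      (Sum.inl (Fin.last n))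
    convert h using 1
    ext w
    simp only [mem_setOf_eq, Fin.init_snoc, Fin.snoc_last]

end Rel

/-! ### Arithmetic, lattice operations, order statistics -/

section Arith

variable (hL : IsRealFieldExpansion L) {s : Set (Fin n → ℝ)} {f g : (Fin n → ℝ) → ℝ}
include hL

namespace IsDefinableFunOn

/-- Sums of functions definable on `s` are definable on `s`. [cite: Dries1998, Ch. 1 (2.3)] -/
theorem add (hf : IsDefinableFunOn L s f) (hg : IsDefinableFunOn L s g) :
    IsDefinableFunOn L s (fun x => f x + g x) := by
  refine IsDefinableFunOn.of_rel (N := 2) hf.definable_source (f := ![f, g]) (fun i => ?_)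
    (R := fun a t => t = a 0 + a 1) ?_ (fun x _ t => ?_)
  · fin_cases i
    · exact hf
    · exact hg
  · exact definable_setOf_eq' (definableFun_proj _)
      (hL.definableFun_add (definableFun_proj _) (definableFun_proj _))
  · simp

/-- Products of functions definable on `s` are definable on `s`. [cite: Dries1998, Ch. 1 (2.3)] -/
theorem mul (hf : IsDefinableFunOn L s f) (hg : IsDefinableFunOn L s g) :
    IsDefinableFunOn L s (fun x => f x * g x) := by
  refine IsDefinableFunOn.of_rel (N := 2) hf.definable_source (f := ![f, g]) (fun i => ?_)
    (R := fun a t => t = a 0 * a 1) ?_ (fun x _ t => ?_)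
  · fin_cases i
    · exact hf
    · exact hg
  · exact definable_setOf_eq' (definableFun_proj _)
      (hL.definableFun_mul (definableFun_proj _) (definableFun_proj _))
  · simp

/-- Differences of functions definable on `s` are definable on `s`. [cite: Dries1998, Ch. 1 (2.3)] -/
theorem sub (hf : IsDefinableFunOn L s f) (hg : IsDefinableFunOn L s g) :
    IsDefinableFunOn L s (fun x => f x - g x) := by
  refine IsDefinableFunOn.of_rel (N := 2) hf.definable_source (f := ![f, g]) (fun i => ?_)
    (R := fun a t => t = a 0 - a 1) ?_ (fun x _ t => ?_)
  · fin_cases i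
    · exact hf
    · exact hg
  · exact definable_setOf_eq' (definableFun_proj _)
      (hL.definableFun_sub (definableFun_proj _) (definableFun_proj _))
  · simp

/-- Negatives of functions definable on `s` are definable on `s`. [cite: Dries1998, Ch. 1 (2.3)] -/
theorem neg (hf : IsDefinableFunOn L s f) : IsDefinableFunOn L s (fun x => -f x) := by
  refine IsDefinableFunOn.of_rel (N := 1) hf.definable_source (f := ![f]) (fun i => ?_)
    (R := fun a t => t = -a 0) ?_ (fun x _ t => ?_)
  · fin_cases i
    exact hf
  · exact definable_setOf_eq' (definableFun_proj _) (hL.definableFun_neg (definableFun_proj _))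
  · simp

/-- The pointwise `max` of functions definable on `s` is definable on `s`.
[cite: Dries1998, Ch. 1 (2.3)] -/
theorem max (hf : IsDefinableFunOn L s f) (hg : IsDefinableFunOn L s g) :
    IsDefinableFunOn L s (fun x => max (f x) (g x)) := by
  refine IsDefinableFunOn.of_rel (N := 2) hf.definable_source (f := ![f, g]) (fun i => ?_)
    (R := fun a t => (a 0 ≤ a 1 ∧ t = a 1) ∨ (a 1 < a 0 ∧ t = a 0)) ?_ (fun x _ t => ?_)
  · fin_cases i
    · exact hf
    · exact hg
  · exact definable_setOf_or
      (definable_setOf_and (hL.definable_setOf_le (definableFun_proj _) (definableFun_proj _))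
        (definable_setOf_eq' (definableFun_proj _) (definableFun_proj _)))
      (definable_setOf_and (hL.definable_setOf_lt (definableFun_proj _) (definableFun_proj _))
        (definable_setOf_eq' (definableFun_proj _) (definableFun_proj _)))
  · simp only [Matrix.cons_val_zero, Matrix.cons_val_one]
    constructor
    · rintro (⟨hle, rfl⟩ | ⟨hlt, rfl⟩)
      · exact (max_eq_right hle).symm
      · exact (max_eq_left hlt.le).symm
    · rintro rfl
      rcases le_or_gt (f x) (g x) with hle | hlt
      · exact Or.inl ⟨hle, max_eq_right hle⟩
      · exact Or.inr ⟨hlt, max_eq_left hlt.le⟩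

/-- The pointwise `min` of functions definable on `s` is definable on `s`.
[cite: Dries1998, Ch. 1 (2.3)] -/
theorem min (hf : IsDefinableFunOn L s f) (hg : IsDefinableFunOn L s g) :
    IsDefinableFunOn L s (fun x => min (f x) (g x)) := by
  refine IsDefinableFunOn.of_rel (N := 2) hf.definable_source (f := ![f, g]) (fun i => ?_)
    (R := fun a t => (a 0 ≤ a 1 ∧ t = a 0) ∨ (a 1 < a 0 ∧ t = a 1)) ?_ (fun x _ t => ?_)
  · fin_cases i
    · exact hf
    · exact hg
  · exact definable_setOf_or
      (definable_setOf_and (hL.definable_setOf_le (definableFun_proj _) (definableFun_proj _))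
        (definable_setOf_eq' (definableFun_proj _) (definableFun_proj _)))
      (definable_setOf_and (hL.definable_setOf_lt (definableFun_proj _) (definableFun_proj _))
        (definable_setOf_eq' (definableFun_proj _) (definableFun_proj _)))
  · simp only [Matrix.cons_val_zero, Matrix.cons_val_one]
    constructor
    · rintro (⟨hle, rfl⟩ | ⟨hlt, rfl⟩)
      · exact (min_eq_left hle).symm
      · exact (min_eq_right hlt.le).symm
    · rintro rfl
      rcases le_or_gt (f x) (g x) with hle | hlt
      · exact Or.inl ⟨hle, min_eq_left hle⟩
      · exact Or.inr ⟨hlt, min_eq_right hlt.le⟩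

/-- The pointwise quotient (with Lean's `a / 0 = 0`) of functions definable on `s` is definable on
`s`. [cite: Dries1998, Ch. 1 (2.3)] -/
theorem div₀ (hf : IsDefinableFunOn L s f) (hg : IsDefinableFunOn L s g) :
    IsDefinableFunOn L s (fun x => f x / g x) := by
  refine IsDefinableFunOn.of_rel (N := 2) hf.definable_source (f := ![f, g]) (fun i => ?_)
    (R := fun a t => (a 1 = 0 ∧ t = 0) ∨ (¬ a 1 = 0 ∧ t * a 1 = a 0)) ?_ (fun x _ t => ?_)
  · fin_cases i
    · exact hf
    · exact hg
  · exact definable_setOf_or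
      (definable_setOf_and (definable_setOf_eq' (definableFun_proj _) (definableFun_const' _ _))
        (definable_setOf_eq' (definableFun_proj _) (definableFun_const' _ _)))
      (definable_setOf_and
        (definable_setOf_not (definable_setOf_eq' (definableFun_proj _) (definableFun_const' _ _)))
        (definable_setOf_eq' (hL.definableFun_mul (definableFun_proj _) (definableFun_proj _))
          (definableFun_proj _)))
  · simp only [Matrix.cons_val_zero, Matrix.cons_val_one]
    constructor
    · rintro (⟨h0, rfl⟩ | ⟨h0, h⟩)
      · rw [h0, div_zero]
      · rw [eq_div_iff h0, h]
    · rintro rfl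
      by_cases h0 : g x = 0
      · exact Or.inl ⟨h0, by rw [h0, div_zero]⟩
      · exact Or.inr ⟨h0, div_mul_cancel₀ _ h0⟩

omit hL in
/-- Finite sums of functions definable on a definable `s` are definable on `s`.
[cite: Dries1998, Ch. 1 (2.3)] -/
theorem finset_sum (hL : IsRealFieldExpansion L) {ι : Type*} (hs : (univ : Set ℝ).Definable L s)
    (I : Finset ι) {f : ι → (Fin n → ℝ) → ℝ} (hf : ∀ i ∈ I, IsDefinableFunOn L s (f i)) :
    IsDefinableFunOn L s (fun x => ∑ i ∈ I, f i x) := by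
  classical
  induction I using Finset.induction_on with
  | empty => simpa using isDefinableFunOn_const hs 0
  | insert a I ha ih =>
    have h := IsDefinableFunOn.add hL (hf a (Finset.mem_insert_self a I))
      (ih fun i hi => hf i (Finset.mem_insert_of_mem hi))
    refine h.congr fun x _ => ?_
    simp [Finset.sum_insert ha]

omit hL in
/-- Disjunctions over a finset of definable conditions are definable. [folklore] -/
theorem _root_.Literature.ModelTheory.ExponentialFields.definable_setOf_exists_mem_finset
    {γ ι : Type*} (I : Finset ι) {P : ι → (γ → ℝ) → Prop}
    (h : ∀ i ∈ I, (univ : Set ℝ).Definable L {v | P i v}) :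
    (univ : Set ℝ).Definable L {v : γ → ℝ | ∃ i ∈ I, P i v} := by
  classical
  have heq : {v : γ → ℝ | ∃ i ∈ I, P i v} = ⋃ i ∈ I, {v | P i v} := by
    ext v
    simp
  rw [heq]
  clear heq
  induction I using Finset.induction_on with
  | empty => simp
  | insert a I ha ih =>
    rw [Finset.set_biUnion_insert]
    exact (h a (Finset.mem_insert_self a I)).union (ih fun i hi => h i (Finset.mem_insert_of_mem hi))

omit hL in
/-- Conjunctions over a finset of definable conditions are definable. [folklore] -/
theorem _root_.Literature.ModelTheory.ExponentialFields.definable_setOf_forall_mem_finset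
    {γ ι : Type*} (I : Finset ι) {P : ι → (γ → ℝ) → Prop}
    (h : ∀ i ∈ I, (univ : Set ℝ).Definable L {v | P i v}) :
    (univ : Set ℝ).Definable L {v : γ → ℝ | ∀ i ∈ I, P i v} := by
  have h' := (definable_setOf_exists_mem_finset I (P := fun i v => ¬ P i v)
    fun i hi => (h i hi).compl).compl
  convert h' using 1
  ext v
  simp

omit hL in
/-- Existential quantification over a finite index type of definable conditions is definable.
[folklore] -/
theorem _root_.Literature.ModelTheory.ExponentialFields.definable_setOf_exists_index
    {γ ι : Type*} [Finite ι] {P : ι → (γ → ℝ) → Prop}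
    (h : ∀ i, (univ : Set ℝ).Definable L {v | P i v}) :
    (univ : Set ℝ).Definable L {v : γ → ℝ | ∃ i, P i v} := by
  have heq : {v : γ → ℝ | ∃ i, P i v} = ⋃ i, {v | P i v} := by
    ext v
    simp
  rw [heq]
  exact Set.definable_iUnion_of_finite h

omit hL in
/-- A condition that does not depend on the variables is definable. [folklore] -/
theorem _root_.Literature.ModelTheory.ExponentialFields.definable_setOf_const_prop {γ : Type*}
    (p : Prop) : (univ : Set ℝ).Definable L {_v : γ → ℝ | p} := by
  by_cases hp : p
  · simp only [hp, setOf_true]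
    exact Set.definable_univ
  · simp only [hp, setOf_false]
    exact Set.definable_empty

/-- **Order statistics of definable functions are definable** (via the first-order characterisation
`eq_sort_apply_iff` of the tree). [cite: Dries1998, Ch. 1 (2.3)] -/
theorem sort_apply {m : ℕ} {f : Fin m → (Fin n → ℝ) → ℝ} (hs : (univ : Set ℝ).Definable L s)
    (hf : ∀ i, IsDefinableFunOn L s (f i)) (k : Fin m) :
    IsDefinableFunOn L s (fun x => (fun i => f i x) (Tuple.sort (fun i => f i x) k)) := by
  refine IsDefinableFunOn.of_rel hs hf
    (R := fun a t => (∀ I : Finset (Fin m), I.card = (k : ℕ) + 1 → ∃ i ∈ I, t ≤ a i) ∧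
      ∃ I : Finset (Fin m), I.card = (k : ℕ) + 1 ∧ ∀ i ∈ I, a i ≤ t) ?_
    (fun x _ t => eq_sort_apply_iff (fun i => f i x) k t)
  refine definable_setOf_and (definable_setOf_forall_index fun I => definable_setOf_imp
    (definable_setOf_const_prop _) (definable_setOf_exists_mem_finset I fun i _ => ?_))
    (definable_setOf_exists_index fun I => definable_setOf_and (definable_setOf_const_prop _)
      (definable_setOf_forall_mem_finset I fun i _ => ?_))
  · exact hL.definable_setOf_le (definableFun_proj _) (definableFun_proj _)
  · exact hL.definable_setOf_le (definableFun_proj _) (definableFun_proj _)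

/-- The super-graph `{z | init z ∈ s ∧ f (init z) ≤ z last}` of a function definable on `s` is
definable. [cite: Dries1998, Ch. 1 (2.3)] -/
theorem definable_setOf_le_last (hf : IsDefinableFunOn L s f) :
    (univ : Set ℝ).Definable L {z : Fin (n + 1) → ℝ | Fin.init z ∈ s ∧ f (Fin.init z) ≤ z (Fin.last n)} := by
  have hΓ := isDefinableFunOn_iff.1 hf
  have key : {z : Fin (n + 1) → ℝ | Fin.init z ∈ s ∧ f (Fin.init z) ≤ z (Fin.last n)} =
      {z : Fin (n + 1) → ℝ | ∃ t : ℝ, (Fin.snoc (Fin.init z) t : Fin (n + 1) → ℝ) ∈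
        {z' : Fin (n + 1) → ℝ | Fin.init z' ∈ s ∧ z' (Fin.last n) = f (Fin.init z')} ∧
          t ≤ z (Fin.last n)} := by
    ext z
    simp only [mem_setOf_eq, Fin.init_snoc, Fin.snoc_last]
    constructor
    · rintro ⟨hz, hle⟩
      exact ⟨f (Fin.init z), ⟨hz, rfl⟩, hle⟩
    · rintro ⟨t, ⟨hz, rfl⟩, hle⟩
      exact ⟨hz, hle⟩
  rw [key]
  refine definable_setOf_exists (P := fun (z : Fin (n + 1) → ℝ) (t : ℝ) =>
    (Fin.snoc (Fin.init z) t : Fin (n + 1) → ℝ) ∈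
      {z' : Fin (n + 1) → ℝ | Fin.init z' ∈ s ∧ z' (Fin.last n) = f (Fin.init z')} ∧
        t ≤ z (Fin.last n)) ?_
  refine definable_setOf_and ?_ (hL.definable_setOf_le (definableFun_proj _) (definableFun_proj _))
  exact definable_setOf_snoc_mem' hΓ (fun j : Fin n => Sum.inl (Fin.castSucc j)) (Sum.inr ())

/-- The sub-graph `{z | init z ∈ s ∧ z last ≤ f (init z)}` of a function definable on `s` is
definable. [cite: Dries1998, Ch. 1 (2.3)] -/
theorem definable_setOf_last_le (hf : IsDefinableFunOn L s f) :
    (univ : Set ℝ).Definable L {z : Fin (n + 1) → ℝ | Fin.init z ∈ s ∧ z (Fin.last n) ≤ f (Fin.init z)} := by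
  have hΓ := isDefinableFunOn_iff.1 hf
  have key : {z : Fin (n + 1) → ℝ | Fin.init z ∈ s ∧ z (Fin.last n) ≤ f (Fin.init z)} =
      {z : Fin (n + 1) → ℝ | ∃ t : ℝ, (Fin.snoc (Fin.init z) t : Fin (n + 1) → ℝ) ∈
        {z' : Fin (n + 1) → ℝ | Fin.init z' ∈ s ∧ z' (Fin.last n) = f (Fin.init z')} ∧
          z (Fin.last n) ≤ t} := by
    ext z
    simp only [mem_setOf_eq, Fin.init_snoc, Fin.snoc_last]
    constructor
    · rintro ⟨hz, hle⟩
      exact ⟨f (Fin.init z), ⟨hz, rfl⟩, hle⟩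
    · rintro ⟨t, ⟨hz, rfl⟩, hle⟩
      exact ⟨hz, hle⟩
  rw [key]
  refine definable_setOf_exists (P := fun (z : Fin (n + 1) → ℝ) (t : ℝ) =>
    (Fin.snoc (Fin.init z) t : Fin (n + 1) → ℝ) ∈
      {z' : Fin (n + 1) → ℝ | Fin.init z' ∈ s ∧ z' (Fin.last n) = f (Fin.init z')} ∧
        z (Fin.last n) ≤ t) ?_
  refine definable_setOf_and ?_ (hL.definable_setOf_le (definableFun_proj _) (definableFun_proj _))
  exact definable_setOf_snoc_mem' hΓ (fun j : Fin n => Sum.inl (Fin.castSucc j)) (Sum.inr ())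

end IsDefinableFunOn

end Arith

/-! ### Maps -/

section Maps

variable {s t : Set (Fin n → ℝ)} {F : (Fin n → ℝ) → (Fin m → ℝ)}

/-- **A map is definable on `s` iff its coordinates are** (for definable `s`).
[cite: Dries1998, Ch. 1 (2.3)] -/
theorem isDefinableMapOn_iff_forall (hs : (univ : Set ℝ).Definable L s) :
    IsDefinableMapOn L s F ↔ ∀ j, IsDefinableFunOn L s (fun x => F x j) := by
  constructor
  · intro h j
    rw [IsDefinableMapOn] at h
    rw [isDefinableFunOn_iff]
    have key : {z : Fin (n + 1) → ℝ | Fin.init z ∈ s ∧ z (Fin.last n) = F (Fin.init z) j} =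
        {z : Fin (n + 1) → ℝ | ∃ y : Fin m → ℝ, (Fin.append (Fin.init z) y : Fin (n + m) → ℝ) ∈
          {z' : Fin (n + m) → ℝ | ∃ x ∈ s, z' = Fin.append x (F x)} ∧ y j = z (Fin.last n)} := by
      ext z
      simp only [mem_setOf_eq]
      constructor
      · rintro ⟨hz, hj⟩
        exact ⟨F (Fin.init z), ⟨Fin.init z, hz, rfl⟩, hj.symm⟩
      · rintro ⟨y, ⟨x, hx, hxy⟩, hj⟩
        have h1 : Fin.init z = x := by
          funext i
          have := congr_fun hxy (Fin.castAdd m i)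
          simpa only [Fin.append_left] using this
        have h2 : y = F x := by
          funext j'
          have := congr_fun hxy (Fin.natAdd n j')
          simpa only [Fin.append_right] using this
        subst h1
        exact ⟨hx, by rw [← hj, h2]⟩
    rw [key]
    refine definable_setOf_exists_fin (P := fun (z : Fin (n + 1) → ℝ) (y : Fin m → ℝ) =>
      (Fin.append (Fin.init z) y : Fin (n + m) → ℝ) ∈
        {z' : Fin (n + m) → ℝ | ∃ x ∈ s, z' = Fin.append x (F x)} ∧ y j = z (Fin.last n)) ?_
    refine definable_setOf_and ?_ (definable_setOf_eq' (definableFun_proj _) (definableFun_proj _))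
    have h' := h.preimage_comp (Fin.append (fun i : Fin n => (Sum.inl (Fin.castSucc i) :
      Fin (n + 1) ⊕ Fin m)) (fun j : Fin m => Sum.inr j) : Fin (n + m) → Fin (n + 1) ⊕ Fin m)
    convert h' using 1
    ext w
    simp only [mem_setOf_eq, mem_preimage]
    have hw : (Fin.append (Fin.init fun i => w (Sum.inl i)) fun j => w (Sum.inr j)) =
        w ∘ (Fin.append (fun i : Fin n => (Sum.inl (Fin.castSucc i) : Fin (n + 1) ⊕ Fin m))
          (fun j : Fin m => Sum.inr j)) := by
      funext l
      refine Fin.addCases (fun i => ?_) (fun j => ?_) l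
      · simp only [Fin.append_left, Function.comp_apply]
        rfl
      · simp only [Fin.append_right, Function.comp_apply]
    rw [hw]
  · intro h
    rw [isDefinableMapOn_iff]
    have hΓ : ∀ j, (univ : Set ℝ).Definable L
        {z : Fin (n + 1) → ℝ | Fin.init z ∈ s ∧ z (Fin.last n) = F (Fin.init z) j} :=
      fun j => isDefinableFunOn_iff.1 (h j)
    have key : {z : Fin (n + m) → ℝ | (fun i => z (Fin.castAdd m i)) ∈ s ∧
        (fun j => z (Fin.natAdd n j)) = F (fun i => z (Fin.castAdd m i))} =
        {z : Fin (n + m) → ℝ | (fun i => z (Fin.castAdd m i)) ∈ s ∧ ∀ j,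
          (Fin.snoc (fun i => z (Fin.castAdd m i)) (z (Fin.natAdd n j)) : Fin (n + 1) → ℝ) ∈
            {z' : Fin (n + 1) → ℝ | Fin.init z' ∈ s ∧ z' (Fin.last n) = F (Fin.init z') j}} := by
      ext z
      simp only [mem_setOf_eq, Fin.init_snoc, Fin.snoc_last]
      constructor
      · rintro ⟨hz, hF⟩
        exact ⟨hz, fun j => ⟨hz, congr_fun hF j⟩⟩
      · rintro ⟨hz, hF⟩
        exact ⟨hz, funext fun j => (hF j).2⟩
    rw [key]
    refine definable_setOf_and (hs.preimage_comp (Fin.castAdd m)) ?_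
    exact definable_setOf_forall_index fun j =>
      definable_setOf_snoc_mem' (hΓ j) (fun i : Fin n => Fin.castAdd m i) (Fin.natAdd n j)

/-- A map with definable coordinates on a definable `s` is definable on `s`. [cite: Dries1998, Ch. 1 (2.3)] -/
theorem IsDefinableMapOn.of_forall (hs : (univ : Set ℝ).Definable L s)
    (h : ∀ j, IsDefinableFunOn L s (fun x => F x j)) : IsDefinableMapOn L s F :=
  (isDefinableMapOn_iff_forall hs).2 h

/-- The coordinates of a map definable on a definable `s` are definable on `s`.
[cite: Dries1998, Ch. 1 (2.3)] -/
theorem IsDefinableMapOn.apply (hF : IsDefinableMapOn L s F) (hs : (univ : Set ℝ).Definable L s)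
    (j : Fin m) : IsDefinableFunOn L s (fun x => F x j) :=
  (isDefinableMapOn_iff_forall hs).1 hF j

/-- Restriction of a definable map to a definable subset. [folklore] -/
theorem IsDefinableMapOn.mono (hF : IsDefinableMapOn L s F) (hts : t ⊆ s)
    (ht : (univ : Set ℝ).Definable L t) : IsDefinableMapOn L t F := by
  rw [isDefinableMapOn_iff] at hF ⊢
  have key : {z : Fin (n + m) → ℝ | (fun i => z (Fin.castAdd m i)) ∈ t ∧
      (fun j => z (Fin.natAdd n j)) = F (fun i => z (Fin.castAdd m i))} =
      {z : Fin (n + m) → ℝ | (fun i => z (Fin.castAdd m i)) ∈ s ∧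
        (fun j => z (Fin.natAdd n j)) = F (fun i => z (Fin.castAdd m i))} ∩
        {z : Fin (n + m) → ℝ | (fun i => z (Fin.castAdd m i)) ∈ t} := by
    ext z
    simp only [mem_setOf_eq, mem_inter_iff]
    constructor
    · rintro ⟨hz, h⟩
      exact ⟨⟨hts hz, h⟩, hz⟩
    · rintro ⟨⟨-, h⟩, hz⟩
      exact ⟨hz, h⟩
  rw [key]
  exact hF.inter (ht.preimage_comp (Fin.castAdd m))

/-- **`{x ∈ s | F x ∈ t}` is definable** for a map `F` definable on `s` and a definable `t`
(preimages under definable maps). [cite: Dries1998, Ch. 1 (2.3)] -/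
theorem IsDefinableMapOn.definable_sep_mem (hF : IsDefinableMapOn L s F) {t : Set (Fin m → ℝ)}
    (ht : (univ : Set ℝ).Definable L t) : (univ : Set ℝ).Definable L {x | x ∈ s ∧ F x ∈ t} := by
  rw [IsDefinableMapOn] at hF
  have key : {x : Fin n → ℝ | x ∈ s ∧ F x ∈ t} = {x : Fin n → ℝ | ∃ y : Fin m → ℝ,
      (Fin.append x y : Fin (n + m) → ℝ) ∈ {z : Fin (n + m) → ℝ | ∃ x ∈ s, z = Fin.append x (F x)} ∧
        y ∈ t} := by
    ext x
    simp only [mem_setOf_eq]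
    constructor
    · rintro ⟨hx, hFx⟩
      exact ⟨F x, ⟨x, hx, rfl⟩, hFx⟩
    · rintro ⟨y, ⟨x', hx', hxy⟩, hy⟩
      have h1 : x = x' := by
        funext i
        have := congr_fun hxy (Fin.castAdd m i)
        simpa only [Fin.append_left] using this
      have h2 : y = F x' := by
        funext j
        have := congr_fun hxy (Fin.natAdd n j)
        simpa only [Fin.append_right] using this
      subst h1
      exact ⟨hx', h2 ▸ hy⟩
  rw [key]
  refine definable_setOf_exists_fin (P := fun (x : Fin n → ℝ) (y : Fin m → ℝ) =>
    (Fin.append x y : Fin (n + m) → ℝ) ∈ {z : Fin (n + m) → ℝ | ∃ x ∈ s, z = Fin.append x (F x)} ∧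
      y ∈ t) ?_
  refine definable_setOf_and ?_ (ht.preimage_comp Sum.inr)
  have h' := hF.preimage_comp (finSumFinEquiv.symm : Fin (n + m) → Fin n ⊕ Fin m)
  convert h' using 1
  ext w
  simp only [mem_setOf_eq, mem_preimage]
  have hw : Fin.append (fun i => w (Sum.inl i)) (fun j => w (Sum.inr j)) =
      (w ∘ (finSumFinEquiv.symm : Fin (n + m) → Fin n ⊕ Fin m)) := by
    funext l
    refine Fin.addCases (fun i => ?_) (fun j => ?_) l
    · simp only [Fin.append_left, Function.comp_apply, finSumFinEquiv_symm_apply_castAdd]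
    · simp only [Fin.append_right, Function.comp_apply, finSumFinEquiv_symm_apply_natAdd]
  rw [hw]

/-- **Composition**: `g ∘ F` is definable on `s` for `F` a map definable on `s` into `t` and `g` a
function definable on `t`. [cite: Dries1998, Ch. 1 (2.3)] -/
theorem IsDefinableFunOn.comp_isDefinableMapOn {t : Set (Fin m → ℝ)} {g : (Fin m → ℝ) → ℝ}
    (hg : IsDefinableFunOn L t g) (hF : IsDefinableMapOn L s F) (hst : MapsTo F s t) :
    IsDefinableFunOn L s (fun x => g (F x)) := by
  have hΓg := isDefinableFunOn_iff.1 hg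
  rw [IsDefinableMapOn] at hF
  rw [isDefinableFunOn_iff]
  have key : {z : Fin (n + 1) → ℝ | Fin.init z ∈ s ∧ z (Fin.last n) = g (F (Fin.init z))} =
      {z : Fin (n + 1) → ℝ | ∃ y : Fin m → ℝ, (Fin.append (Fin.init z) y : Fin (n + m) → ℝ) ∈
        {z' : Fin (n + m) → ℝ | ∃ x ∈ s, z' = Fin.append x (F x)} ∧
        (Fin.snoc y (z (Fin.last n)) : Fin (m + 1) → ℝ) ∈
          {z' : Fin (m + 1) → ℝ | Fin.init z' ∈ t ∧ z' (Fin.last m) = g (Fin.init z')}} := by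
    ext z
    simp only [mem_setOf_eq, Fin.init_snoc, Fin.snoc_last]
    constructor
    · rintro ⟨hz, hgF⟩
      exact ⟨F (Fin.init z), ⟨Fin.init z, hz, rfl⟩, hst hz, hgF⟩
    · rintro ⟨y, ⟨x, hx, hxy⟩, hyt, hgy⟩
      have h1 : Fin.init z = x := by
        funext i
        have := congr_fun hxy (Fin.castAdd m i)
        simpa only [Fin.append_left] using this
      have h2 : y = F x := by
        funext j
        have := congr_fun hxy (Fin.natAdd n j)
        simpa only [Fin.append_right] using this
      rw [h1]
      exact ⟨hx, by rw [hgy, h2]⟩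
  rw [key]
  refine definable_setOf_exists_fin (P := fun (z : Fin (n + 1) → ℝ) (y : Fin m → ℝ) =>
    (Fin.append (Fin.init z) y : Fin (n + m) → ℝ) ∈
      {z' : Fin (n + m) → ℝ | ∃ x ∈ s, z' = Fin.append x (F x)} ∧
      (Fin.snoc y (z (Fin.last n)) : Fin (m + 1) → ℝ) ∈
        {z' : Fin (m + 1) → ℝ | Fin.init z' ∈ t ∧ z' (Fin.last m) = g (Fin.init z')}) ?_
  refine definable_setOf_and ?_ (definable_setOf_snoc_mem' hΓg (fun j : Fin m => Sum.inr j)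
    (Sum.inl (Fin.last n)))
  have h' := hF.preimage_comp (Fin.append (fun i : Fin n => (Sum.inl (Fin.castSucc i) :
    Fin (n + 1) ⊕ Fin m)) (fun j : Fin m => Sum.inr j) : Fin (n + m) → Fin (n + 1) ⊕ Fin m)
  convert h' using 1
  ext w
  simp only [mem_setOf_eq, mem_preimage]
  have hw : (Fin.append (Fin.init fun i => w (Sum.inl i)) fun j => w (Sum.inr j)) =
      w ∘ (Fin.append (fun i : Fin n => (Sum.inl (Fin.castSucc i) : Fin (n + 1) ⊕ Fin m))
        (fun j : Fin m => Sum.inr j)) := by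
    funext l
    refine Fin.addCases (fun i => ?_) (fun j => ?_) l
    · simp only [Fin.append_left, Function.comp_apply]
      rfl
    · simp only [Fin.append_right, Function.comp_apply]
  rw [hw]

/-- **Piecewise definability**: a function definable on each piece of a finite cover of `s` is
definable on `s` (the graph over a union is the union of the graphs). [folklore] -/
theorem IsDefinableFunOn.of_finset_cover {ι : Type*} {f : (Fin n → ℝ) → ℝ} (I : Finset ι)
    (S : ι → Set (Fin n → ℝ)) (hcover : s = ⋃ i ∈ I, S i)
    (h : ∀ i ∈ I, IsDefinableFunOn L (S i) f) : IsDefinableFunOn L s f := by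
  classical
  unfold IsDefinableFunOn at h ⊢
  have key : {z : Fin (n + 1) → ℝ | ∃ x ∈ s, z = Fin.snoc x (f x)} =
      ⋃ i ∈ I, {z : Fin (n + 1) → ℝ | ∃ x ∈ S i, z = Fin.snoc x (f x)} := by
    ext z
    simp only [hcover, mem_setOf_eq, mem_iUnion, exists_prop]
    constructor
    · rintro ⟨x, ⟨i, hi, hx⟩, rfl⟩
      exact ⟨i, hi, x, hx, rfl⟩
    · rintro ⟨i, hi, x, hx, rfl⟩
      exact ⟨x, ⟨i, hi, hx⟩, rfl⟩
  rw [key]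
  clear key hcover
  induction I using Finset.induction_on with
  | empty => simp
  | insert a I ha ih =>
    rw [Finset.set_biUnion_insert]
    exact (h a (Finset.mem_insert_self a I)).union (ih fun i hi => h i (Finset.mem_insert_of_mem hi))

/-- Real affine functionals are definable on every definable set (expansion of the real field).
[cite: Dries1998, Ch. 1 (2.3)] -/
theorem AffineMap.isDefinableFunOn (hL : IsRealFieldExpansion L) (A : (Fin n → ℝ) →ᵃ[ℝ] ℝ)
    (hs : (univ : Set ℝ).Definable L s) : IsDefinableFunOn L s A :=
  IsDefinableFunOn.of_definableFun hs (hL.definableFun_affineMap A)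

/-- Real linear maps are definable maps on every definable set (expansion of the real field).
[cite: Dries1998, Ch. 1 (2.3)] -/
theorem LinearMap.isDefinableMapOn (hL : IsRealFieldExpansion L) (A : (Fin n → ℝ) →ₗ[ℝ] (Fin m → ℝ))
    (hs : (univ : Set ℝ).Definable L s) : IsDefinableMapOn L s (fun x => A x) :=
  IsDefinableMapOn.of_forall hs fun j =>
    IsDefinableFunOn.of_definableFun hs (hL.definableMap_linearMap A j)

/-- The identity is a definable map on every definable set. [folklore] -/
theorem isDefinableMapOn_id (hs : (univ : Set ℝ).Definable L s) :
    IsDefinableMapOn L s (fun x : Fin n → ℝ => x) :=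
  IsDefinableMapOn.of_forall hs fun j => isDefinableFunOn_apply hs j

end Maps

end Defs

end Literature.ModelTheory.ExponentialFields
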